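import Summits.AtomisticToContinuum.Crystallization.Theorems.FrustratedLawDichotomyThickeningStationary

/-!
# FrustratedLawDichotomy · crux `AperiodicFrustratedLawGap` (stmt-AtomisticToContinuum-27623) — COVARIANT THICKENING OF LAWS, part 2:
# THICKENING (INSERTION) STABILITY — minimising laws have no pattern-selected family of `e⋆`-deep holes
# (decomp-a2c, prover hand 2, structural share, generation 4)

The dual of `FrustratedLawDichotomyThinning.thinning_stability`.  For a point-stationary `δ`-hard-core probability law `P`, a Giry-measurable
PATTERN `A` and an offset `u` such that the inserted sites `p + u` (`θ_p μ ∈ A`) are almost surely `s`-vacant, the normalised thickened law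
`(1 + P A)⁻¹ · (P ∘ Ins⁻¹ + (P|A) ∘ (θ_u ∘ Ins)⁻¹)` is an admissible competitor (point-stationary, `min δ s`-hard-core, part 1), so the energy
floor of item 9229 (hypothesis `hU`, PROVED in the tree as `PalmUnimodularRigidity.UnimodularEnergyLowerBound`) gives

  `thickening_stability`:  `(1 + P(A))·e⋆ ≤ E_P[rootEnergy ∘ Ins] + ∫_A rootEnergy(θ_u Ins μ) dP(μ)`.

The two energies are explicit (`rootEnergy_ins`, `rootEnergy_ins_copy`): with `K = {p : θ_p μ ∈ A}` the pattern atoms,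
`rootEnergy(Ins μ) = rootEnergy μ + ½ Σ_{p ∈ K} V_LJ(‖p + u‖)` (the old root also sees the inserted atoms) and
`rootEnergy(θ_u Ins μ) = ½ Σ_{q ∈ μ} V_LJ(‖q − u‖) + ½ Σ_{p ∈ K} V_LJ(‖p‖)` (the inserted root sees the field `Φ_μ(u)` of the old configuration
and the other inserted atoms, which sit at the mutual offsets of their parents).  For a MINIMISER (`E_P[rootEnergy] ≤ e⋆`) this is the law-level
form of Sütő's one-atom INSERTION test for `e⋆`-μ-ground-state configurations (`insertionPrice_of_minimising`):

  `P(A)·e⋆ ≤ ½ E_P[Σ_{p∈K} V_LJ(‖p+u‖)] + ½ ∫_A Φ_μ(u) dP + ½ ∫_A Σ_{p∈K∖0} V_LJ(‖p‖) dP`,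

i.e. (by the Mecke identity the first term equals `½ ∫_A Φ_μ(u) dP`) the pattern-selected holes `u` have mean field `Φ_μ(u) ≥ e⋆` up to the
(attractive, once the pattern atoms are `≥ 2^{-1/6}` apart) mutual interaction of the inserted atoms.  Teeth: a vacancy-type cavity of a
close-packed matrix has `Φ ≈ 2 e(fcc) ≈ −1.43 < e⋆ ≈ −0.7175` and is excluded, whereas the minimality-free Nash floor `2e⋆ − 1/12` is not violated
by it.  All `[folklore]` (Palm calculus; the `k = 1` insertion instance of "minimising laws are a.s. `e⋆`-μGSC",
`PalmUnimodularRigidityMinimiserShells.EquilibriumInLaw.stub_equilibriumInLaw`, whose module chain is not built on the farm at the time of writing).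
-/

noncomputable section

namespace Summit.AtomisticToContinuum.Crystallization.Theorems.FrustratedLawDichotomyThickening

open MeasureTheory Metric Set Filter ProbabilityTheory
open scoped ENNReal Topology BigOperators
open Literature.MathematicalPhysics.StatisticalMechanics Literature.Probability.Process
open Summit.AtomisticToContinuum.Crystallization.Theorems.ChargedEnergyGapNegative (E3 eStar)
open Summit.AtomisticToContinuum.Crystallization.Theorems.BenjaminiSchrammLimit (measurableSet_setOf_isRootedHardCore)
open Summit.AtomisticToContinuum.Crystallization.Theorems.FrustratedLawDichotomyFiniteClusterGap
  (ae_mem_of_sep measurable_ofReal_lennardJones_parts lintegral_lennardJones_parts_map_sub_le integrable_rootEnergy_of_ae_hardCore)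

variable {δ : ℝ} {A : Set (Measure E3)}

/-! ## §1. Energies of a thickened configuration -/

section Energy

/-- The Lennard-Jones field of the root is integrable against a rooted hard-core configuration (shell bounds of the prelude). [folklore] -/
theorem integrable_lennardJones_of_hardCore (hδ : 0 < δ) {ν : Measure E3} (hν : IsRootedHardCore δ ν) :
    Integrable (fun z : E3 => lennardJones ‖z‖) ν := by
  have hLJm : Measurable fun y : E3 => lennardJones ‖y‖ := by
    have : Measurable lennardJones := by unfold lennardJones; fun_prop
    exact this.comp measurable_norm
  obtain ⟨T, h0T, hsepT, rfl⟩ := hν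
  obtain ⟨hp, hm⟩ := measurable_ofReal_lennardJones_parts
  have hb := lintegral_lennardJones_parts_map_sub_le hδ hsepT h0T
  simp only [sub_zero, Measure.map_id'] at hb
  refine ⟨hLJm.aestronglyMeasurable, ?_⟩
  show ∫⁻ y, ‖lennardJones ‖y‖‖ₑ ∂((Measure.count : Measure E3).restrict T) < ∞
  calc ∫⁻ y, ‖lennardJones ‖y‖‖ₑ ∂((Measure.count : Measure E3).restrict T)
      ≤ ∫⁻ y, (ENNReal.ofReal (lennardJones ‖y‖) + ENNReal.ofReal (-lennardJones ‖y‖)) ∂((Measure.count : Measure E3).restrict T) :=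
        lintegral_mono fun y => by
          rw [Real.enorm_eq_ofReal_abs]
          rcases le_total 0 (lennardJones ‖y‖) with h | h
          · rw [abs_of_nonneg h]; exact le_self_add
          · rw [abs_of_nonpos h]; exact le_add_self
    _ = (∫⁻ y, ENNReal.ofReal (lennardJones ‖y‖) ∂((Measure.count : Measure E3).restrict T)) +
          ∫⁻ y, ENNReal.ofReal (-lennardJones ‖y‖) ∂((Measure.count : Measure E3).restrict T) := lintegral_add_left hp _
    _ < ∞ := ENNReal.add_lt_top.2 ⟨hb.1.trans_lt ENNReal.ofReal_lt_top, hb.2.trans_lt ENNReal.ofReal_lt_top⟩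

/-- **Root energy of a thickened configuration**: the old root also sees the inserted atoms,
`rootEnergy(Ins μ) = rootEnergy μ + ½ ∫ V_LJ(‖p + u‖) d(μ|K)(p)`, `K = {p : θ_p μ ∈ A}`. [folklore] -/
theorem rootEnergy_ins (hδ : 0 < δ) {s : ℝ} (hs : 0 < s) {μ : Measure E3} (hμ : IsRootedHardCore δ μ)
    (hK : MeasurableSet {p : E3 | μ.map (fun x : E3 => x - p) ∈ A}) {u : E3}
    (hV : ∀ p q : E3, μ {p} ≠ 0 → μ {q} ≠ 0 → μ.map (fun x : E3 => x - p) ∈ A → s ≤ dist q (p + u)) :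
    Integrable (fun z : E3 => lennardJones ‖z + u‖) (μ.restrict {p : E3 | μ.map (fun x : E3 => x - p) ∈ A}) ∧
    rootEnergy lennardJones (μ + (μ.restrict {p : E3 | μ.map (fun x : E3 => x - p) ∈ A}).map (fun z => z + u)) =
      rootEnergy lennardJones μ + (∫ z, lennardJones ‖z + u‖ ∂(μ.restrict {p : E3 | μ.map (fun x : E3 => x - p) ∈ A})) / 2 := by
  have hLJm : Measurable fun y : E3 => lennardJones ‖y‖ := by
    have : Measurable lennardJones := by unfold lennardJones; fun_prop
    exact this.comp measurable_norm
  have hintI := integrable_lennardJones_of_hardCore (lt_min hδ hs) (isRootedHardCore_ins hδ hs hμ hK hV)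
  have hintμ : Integrable (fun z : E3 => lennardJones ‖z‖) μ := hintI.mono_measure (Measure.le_add_right le_rfl)
  have hintmap : Integrable (fun z : E3 => lennardJones ‖z‖)
      ((μ.restrict {p : E3 | μ.map (fun x : E3 => x - p) ∈ A}).map (fun z => z + u)) :=
    hintI.mono_measure (Measure.le_add_left le_rfl)
  have hintu : Integrable (fun z : E3 => lennardJones ‖z + u‖) (μ.restrict {p : E3 | μ.map (fun x : E3 => x - p) ∈ A}) :=
    (integrable_map_measure hLJm.aestronglyMeasurable (measurable_add_const u).aemeasurable).1 hintmap
  refine ⟨hintu, ?_⟩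
  rw [rootEnergy_def, rootEnergy_def, integral_add_measure hintμ hintmap,
    integral_map (measurable_add_const u).aemeasurable hLJm.aestronglyMeasurable]
  ring

/-- **Root energy of a thickened configuration seen from the inserted atom `u`** (`μ ∈ A`): the new root sees the field of the old
configuration at `u` and the other inserted atoms at the offsets of their parents,
`rootEnergy(θ_u Ins μ) = ½ ∫ V_LJ(‖q − u‖) dμ(q) + ½ ∫ V_LJ(‖p‖) d(μ|K)(p)`. [folklore] -/
theorem rootEnergy_ins_copy (hδ : 0 < δ) {s : ℝ} (hs : 0 < s) {μ : Measure E3} (hμ : IsRootedHardCore δ μ)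
    (hK : MeasurableSet {p : E3 | μ.map (fun x : E3 => x - p) ∈ A}) {u : E3}
    (hV : ∀ p q : E3, μ {p} ≠ 0 → μ {q} ≠ 0 → μ.map (fun x : E3 => x - p) ∈ A → s ≤ dist q (p + u)) (hμA : μ ∈ A) :
    Integrable (fun z : E3 => lennardJones ‖z - u‖) μ ∧
    Integrable (fun z : E3 => lennardJones ‖z‖) (μ.restrict {p : E3 | μ.map (fun x : E3 => x - p) ∈ A}) ∧
    rootEnergy lennardJones ((μ + (μ.restrict {p : E3 | μ.map (fun x : E3 => x - p) ∈ A}).map (fun z => z + u)).map (fun z => z - u)) =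
      (∫ z, lennardJones ‖z - u‖ ∂μ) / 2 + (∫ z, lennardJones ‖z‖ ∂(μ.restrict {p : E3 | μ.map (fun x : E3 => x - p) ∈ A})) / 2 := by
  have hLJm : Measurable fun y : E3 => lennardJones ‖y‖ := by
    have : Measurable lennardJones := by unfold lennardJones; fun_prop
    exact this.comp measurable_norm
  have hLJum : Measurable fun y : E3 => lennardJones ‖y - u‖ := hLJm.comp (measurable_sub_const u)
  have hintJ := integrable_lennardJones_of_hardCore (lt_min hδ hs) (isRootedHardCore_ins_copy hδ hs hμ hK hV hμA)
  have hintI : Integrable (fun z : E3 => lennardJones ‖z - u‖)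
      (μ + (μ.restrict {p : E3 | μ.map (fun x : E3 => x - p) ∈ A}).map (fun z => z + u)) :=
    (integrable_map_measure hLJm.aestronglyMeasurable (measurable_sub_const u).aemeasurable).1 hintJ
  have hintμ : Integrable (fun z : E3 => lennardJones ‖z - u‖) μ := hintI.mono_measure (Measure.le_add_right le_rfl)
  have hintmap : Integrable (fun z : E3 => lennardJones ‖z - u‖)
      ((μ.restrict {p : E3 | μ.map (fun x : E3 => x - p) ∈ A}).map (fun z => z + u)) :=
    hintI.mono_measure (Measure.le_add_left le_rfl)
  have hintK : Integrable (fun z : E3 => lennardJones ‖z + u - u‖) (μ.restrict {p : E3 | μ.map (fun x : E3 => x - p) ∈ A}) :=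
    (integrable_map_measure hLJum.aestronglyMeasurable (measurable_add_const u).aemeasurable).1 hintmap
  simp only [add_sub_cancel_right] at hintK
  refine ⟨hintμ, hintK, ?_⟩
  rw [rootEnergy_def, integral_map (measurable_sub_const u).aemeasurable hLJm.aestronglyMeasurable, integral_add_measure hintμ hintmap,
    integral_map (measurable_add_const u).aemeasurable hLJum.aestronglyMeasurable]
  simp only [add_sub_cancel_right]
  ring

end Energy

/-! ## §2. Thickening stability -/

section Stability

variable {P : Measure (Measure E3)}

/-- **THICKENING (INSERTION) STABILITY.**  Granted the energy floor for point-stationary hard-core probability laws (item 9229, hypothesis `hU`):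
for every point-stationary `δ`-hard-core probability law `P`, every Giry-measurable pattern `A` and every offset `u` whose inserted sites are almost
surely `s`-vacant, `(1 + P(A))·e⋆ ≤ E_P[rootEnergy(Ins μ)] + ∫_A rootEnergy(θ_u Ins μ) dP` — the normalised thickened law is an admissible
competitor of total mass `1 + P(A)`. [folklore] -/
theorem thickening_stability
    (hU : ∀ δ' : ℝ, 0 < δ' → ∀ Q : Measure (Measure E3), IsProbabilityMeasure Q → (∀ᵐ μ ∂Q, IsRootedHardCore δ' μ) →
      IsPointStationaryLaw Q → eStar ≤ ∫ μ, rootEnergy lennardJones μ ∂Q)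
    (hδ : 0 < δ) {s : ℝ} (hs : 0 < s) [IsProbabilityMeasure P] (hcore : ∀ᵐ μ ∂P, IsRootedHardCore δ μ) (hstat : IsPointStationaryLaw P)
    (hA : MeasurableSet A) (u : E3)
    (hV : ∀ᵐ μ ∂P, ∀ p q : E3, μ {p} ≠ 0 → μ {q} ≠ 0 → μ.map (fun x : E3 => x - p) ∈ A → s ≤ dist q (p + u)) :
    (1 + (P A).toReal) * eStar ≤
      (∫ μ, rootEnergy lennardJones (μ + (μ.restrict {p : E3 | μ.map (fun x : E3 => x - p) ∈ A}).map (fun z => z + u)) ∂P) +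
      ∫ μ in A, rootEnergy lennardJones
        ((μ + (μ.restrict {p : E3 | μ.map (fun x : E3 => x - p) ∈ A}).map (fun z => z + u)).map (fun z => z - u)) ∂P := by
  have hδ' : 0 < min δ s := lt_min hδ hs
  obtain ⟨I, hIm, hI⟩ := exists_measurable_ins (A := A) hδ hA u
  set J : Measure E3 → Measure E3 := fun μ => (I μ).map (fun z => z - u) with hJdef
  have hJm : Measurable J := (Measure.measurable_map _ (measurable_sub_const u)).comp hIm
  have hcoreI : ∀ᵐ ν ∂(P.map I), IsRootedHardCore (min δ s) ν := ae_isRootedHardCore_thickened hδ hs hcore u hV hIm hI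
  have hcoreJ : ∀ᵐ ν ∂((P.restrict A).map J), IsRootedHardCore (min δ s) ν :=
    ae_isRootedHardCore_thickened_copy hδ hs hcore hA u hV hIm hI
  set Q : Measure (Measure E3) := P.map I + (P.restrict A).map J with hQ
  -- masses
  have hmI : (P.map I) univ = 1 := by rw [Measure.map_apply hIm MeasurableSet.univ, Set.preimage_univ, measure_univ]
  have hmJ : ((P.restrict A).map J) univ = P A := by
    rw [Measure.map_apply hJm MeasurableSet.univ, Set.preimage_univ, Measure.restrict_apply_univ]
  have hQuniv : Q univ = 1 + P A := by rw [hQ, Measure.add_apply, hmI, hmJ]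
  have hne : (1 + P A) ≠ 0 := by positivity
  have htop : (1 + P A) ≠ ∞ := ENNReal.add_ne_top.2 ⟨ENNReal.one_ne_top, measure_ne_top P A⟩
  haveI : IsFiniteMeasure (P.map I) := ⟨by rw [hmI]; exact ENNReal.one_lt_top⟩
  haveI : IsFiniteMeasure ((P.restrict A).map J) := ⟨by rw [hmJ]; exact measure_lt_top P A⟩
  have hQ' : IsProbabilityMeasure ((1 + P A)⁻¹ • Q) :=
    ⟨by rw [Measure.smul_apply, hQuniv, smul_eq_mul, ENNReal.inv_mul_cancel hne htop]⟩
  -- the floor for the normalised thickened law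
  have hfloor := hU (min δ s) hδ' ((1 + P A)⁻¹ • Q) hQ'
    (Measure.ae_smul_measure ((ae_add_measure_iff).2 ⟨hcoreI, hcoreJ⟩) _)
    ((isPointStationaryLaw_thickened hδ hs hcore hstat hA u hV hIm hI).smul _)
  have hintI : Integrable (fun ν => rootEnergy lennardJones ν) (P.map I) := integrable_rootEnergy_of_ae_hardCore hδ' hcoreI
  have hintJ : Integrable (fun ν => rootEnergy lennardJones ν) ((P.restrict A).map J) := integrable_rootEnergy_of_ae_hardCore hδ' hcoreJ
  rw [integral_smul_measure, hQ, integral_add_measure hintI hintJ, ENNReal.toReal_inv, smul_eq_mul,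
    integral_map hIm.aemeasurable hintI.aestronglyMeasurable, integral_map hJm.aemeasurable hintJ.aestronglyMeasurable] at hfloor
  -- identify the two energies on hard-core configurations
  have hEI : ∫ μ, rootEnergy lennardJones (I μ) ∂P =
      ∫ μ, rootEnergy lennardJones (μ + (μ.restrict {p : E3 | μ.map (fun x : E3 => x - p) ∈ A}).map (fun z => z + u)) ∂P :=
    integral_congr_ae (hcore.mono fun μ hμ => by show rootEnergy lennardJones (I μ) = _; rw [(hI μ hμ).2])
  have hEJ : ∫ μ in A, rootEnergy lennardJones (J μ) ∂P = ∫ μ in A, rootEnergy lennardJones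
      ((μ + (μ.restrict {p : E3 | μ.map (fun x : E3 => x - p) ∈ A}).map (fun z => z + u)).map (fun z => z - u)) ∂P :=
    integral_congr_ae ((ae_restrict_of_ae (s := A) hcore).mono fun μ hμ => by
      show rootEnergy lennardJones ((I μ).map fun z => z - u) = _; rw [(hI μ hμ).2])
  rw [hEI, hEJ] at hfloor
  have hpos : 0 < (1 + P A).toReal := ENNReal.toReal_pos hne htop
  have htr : (1 + P A).toReal = 1 + (P A).toReal := by rw [ENNReal.toReal_add ENNReal.one_ne_top (measure_ne_top P A), ENNReal.toReal_one]
  rw [← htr]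
  calc (1 + P A).toReal * eStar ≤ (1 + P A).toReal * ((1 + P A).toReal⁻¹ * ((∫ μ, rootEnergy lennardJones
          (μ + (μ.restrict {p : E3 | μ.map (fun x : E3 => x - p) ∈ A}).map (fun z => z + u)) ∂P) +
        ∫ μ in A, rootEnergy lennardJones
          ((μ + (μ.restrict {p : E3 | μ.map (fun x : E3 => x - p) ∈ A}).map (fun z => z + u)).map (fun z => z - u)) ∂P)) :=
        mul_le_mul_of_nonneg_left hfloor hpos.le
    _ = _ := by rw [← mul_assoc, mul_inv_cancel₀ hpos.ne', one_mul]

/-- **INSERTION PRICE OF A MINIMISING LAW** (Sütő's one-atom insertion test, law level).  Under the hypotheses of `thickening_stability`, if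
moreover `E_P[rootEnergy] ≤ e⋆` (a minimiser, granted the floor), then
`P(A)·e⋆ ≤ (E_P[rootEnergy ∘ Ins] − E_P[rootEnergy]) + ∫_A rootEnergy(θ_u Ins μ) dP`, where by `rootEnergy_ins` / `rootEnergy_ins_copy` the
right-hand side is `½ E_P[Σ_{p∈K} V_LJ(‖p+u‖)] + ½ ∫_A (Σ_{q} V_LJ(‖q−u‖) + Σ_{p∈K} V_LJ(‖p‖)) dP`: the pattern-selected holes are on average
at most `e⋆`-deep, up to the mutual interaction of the inserted atoms. [folklore] -/
theorem insertionPrice_of_minimising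
    (hU : ∀ δ' : ℝ, 0 < δ' → ∀ Q : Measure (Measure E3), IsProbabilityMeasure Q → (∀ᵐ μ ∂Q, IsRootedHardCore δ' μ) →
      IsPointStationaryLaw Q → eStar ≤ ∫ μ, rootEnergy lennardJones μ ∂Q)
    (hδ : 0 < δ) {s : ℝ} (hs : 0 < s) [IsProbabilityMeasure P] (hcore : ∀ᵐ μ ∂P, IsRootedHardCore δ μ) (hstat : IsPointStationaryLaw P)
    (hA : MeasurableSet A) (u : E3)
    (hV : ∀ᵐ μ ∂P, ∀ p q : E3, μ {p} ≠ 0 → μ {q} ≠ 0 → μ.map (fun x : E3 => x - p) ∈ A → s ≤ dist q (p + u))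
    (hE : ∫ μ, rootEnergy lennardJones μ ∂P ≤ eStar) :
    (P A).toReal * eStar ≤
      ((∫ μ, rootEnergy lennardJones (μ + (μ.restrict {p : E3 | μ.map (fun x : E3 => x - p) ∈ A}).map (fun z => z + u)) ∂P) -
        ∫ μ, rootEnergy lennardJones μ ∂P) +
      ∫ μ in A, rootEnergy lennardJones
        ((μ + (μ.restrict {p : E3 | μ.map (fun x : E3 => x - p) ∈ A}).map (fun z => z + u)).map (fun z => z - u)) ∂P := by
  have h := thickening_stability hU hδ hs hcore hstat hA u hV
  have hPA : 0 ≤ (P A).toReal := ENNReal.toReal_nonneg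
  nlinarith [h, hE, hPA]

end Stability

end Summit.AtomisticToContinuum.Crystallization.Theorems.FrustratedLawDichotomyThickening

end
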